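import Summits.ABC.IUTFork.Joshi.Arithmeticoids

/-!
# Joshi, *ATS II½ — Deformations of Number Fields* (arXiv:2305.10398) §4.7–§4.8, §5.1–§5.7: properties of
# arithmeticoids — Props. 4.7.2 / 4.8.3, Lem. 5.1.3, Def. 5.2.1, Thm. 5.5.2, Cor. 5.7.1 — typed, no side taken

Companion of `Joshi/Arithmeticoids.lean` (block E, rung LADDER-ABC:A2.E, seat abc-iut-E-t37, slot T-37; same source, render and
conventions: [J-2½] = K. Joshi, arXiv:2305.10398, lit key `paper:arxiv-2305.10398`, bib `Joshi2023ATS2half`, «p.N l.M» = line M of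
`HOME/plan/repair/lit/renders/Joshi-arxiv-2305.10398-ATS2half/pNNNN.txt`). TAKES NO SIDE on [IUTchIII] Cor. 3.12, on Joshi's
claims, or on Mochizuki's reports on them; typed ≠ proved; typed AS A CANDIDATE ≠ endorsed; every statement print ASSERTS is a
`def … : Prop` with `@[claim "Joshi2023ATS2half" "disputed"]`, never an axiom / instance / theorem.

CONTENTS (node ids of `HOME/plan/E/JOSHI-DAG.tsv`): J2h:Prop4.7.2 `Prop472` and J2h:Prop4.8.3 `Prop483` (the residue fields
`K_{y_v}` over `𝒴^max_L` / `𝒴^ℝ_L`; «maximally complete» and the residue-field clauses are the UNINTERPRETED predicate fields of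
the signature — Mathlib has no maximally complete valued fields —, the value-group clauses are typed through `valueGroup`);
Lem. 5.1.3 `Lem513` with `algClosureInRing` (the algebraic closure `L̄ ⊂ R_y` an arithmeticoid provides); J2h:Def5.2.1
`TopEquivalent`; J2h:Thm5.5.2 — (3)–(4) `algClosureIn` / `Thm552_34` (claims; the Galois-category packaging of (1)–(5) is prose),
(6) `arith_nonempty` (DERIVED from the point `y⁰` of the proof, p.35 l.1–18), (7) `Thm552_7` (claim, cited by [J-III] Thm.
2.3.1 (b) = seat T-05) with its printed ground `LocalTopInequivalent` ([Kedlaya–Temkin 2018], p.35 l.21–33); J2h:Cor5.7.1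
`threeActions`. NOT HERE: Prop. 5.1.8 / Rmk. 5.2.2 (tilts of arithmeticoids; the tilt data are not recorded, modelling choice
(e) of the main file), Thm. 5.6.1 / Cor. 5.6.2 (multiplicative structures `K̃` of §3.1 — not on the S-spine), §5.8, §5.11–5.13.
-/

noncomputable section

open TopologicalSpace

namespace Summit.ABC.IUTFork.Joshi.ATS2h

namespace DeformationDatum

variable {L : Type} [Field L] {V : Type} {Lv : V → Type} [∀ v, Field (Lv v)] {Y : V → Type}
  [∀ v, TopologicalSpace (Y v)] {K : (v : V) → Y v → Type} [∀ v y, Field (K v y)] [∀ v y, TopologicalSpace (K v y)]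
  {G : V → Type} [∀ v, Group (G v)] {A : V → Type} [∀ v, Group (A v)]
  (D : DeformationDatum L V Lv Y K G A)

/-! ## §4.7–§4.8 The maximally complete and the realified variants (Prop. 4.7.2, Prop. 4.8.3) -/

/-- The value group `|K_y*| ⊂ ℝ_{>0}` of the valued field `(K_y, |−|_{K_y})`. [folklore] -/
def valueGroup (v : V) (y : Y v) : Set ℝ := D.absK v y '' {x | x ≠ 0}

/-- **[J-2½] Prop. 4.7.2** (p.28 l.20–31; «immediate from [FF18] and [Scholze 2012]»): for `y ∈ 𝒴^max_L` and each `v`: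
«(1) the residue field `K_{y_v}` … is a maximally completed (hence algebraically closed) perfectoid field with an isometric
embedding of `L_v`, (2) the value group of `K_{y_v}` is equal to the value group of `L̂_v`, (3) if `v ∈ V^non` the residue field
of `K_{y_v}` is the residue field of `L̂_v`, (4) `K_{y_v}` contains the algebraic closure of `L_v` and also its completion».
Typed over the uninterpreted predicates of the signature ((1) maximal completeness, (3)); (2) via `valueGroup`; the
algebraic-closedness of (1)/(4) as `IsAlgClosed`. [claim: Joshi2023ATS2half, status: disputed] -/
@[claim "Joshi2023ATS2half" "disputed"]
def Prop472 : Prop :=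
  D.IsDef471 → ∀ (y : D.Ycal) (v : V), D.IsMaxComplete v (y v) ∧ IsAlgClosed (K v (y v)) ∧
    D.valueGroup v (y v) = D.valueGroupCompletion v ∧ (v ∉ D.Varc → D.ResidueFieldOfCompletion v (y v))

/-- **[J-2½] Prop. 4.8.3** (p.29 l.19–29): for `y ∈ 𝒴^ℝ_L` and each `v`: «(1) `K_{y_v}` is a maximally completed (hence
algebraically closed) perfectoid field with an isometric embedding of `L_v`, (2) the value group of `K_{y_v}` is equal to
`ℝ`» (i.e. all of `ℝ_{>0}`), «(3) if `v ∈ V^non` the residue field of `K_{y_v}` is `𝔽̄_{p_v}`, (4) `K_{y_v}` contains the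
algebraic closure of `L_v` and its completion». [claim: Joshi2023ATS2half, status: disputed] -/
@[claim "Joshi2023ATS2half" "disputed"]
def Prop483 : Prop :=
  D.IsDef481 → ∀ (y : D.Ycal) (v : V), D.IsMaxComplete v (y v) ∧ IsAlgClosed (K v (y v)) ∧
    D.valueGroup v (y v) = Set.Ioi 0 ∧ (v ∉ D.Varc → D.ResidueFieldFpBar v (y v))

/-! ## §5.1 Lem. 5.1.3, §5.2 Def. 5.2.1 -/

/-- The elements of `R_y` algebraic over `ι_L(L)` — Lem. 5.1.3's «algebraic closure `L̄` of the embedded subfield `L`»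
contained in the arithmetic ring (p.30 l.26–41). [claim: Joshi2023ATS2half, status: disputed] -/
def algClosureInRing (y : D.Arith) : Set (D.arithRing y) :=
  {x | ∃ f : Polynomial L, f ≠ 0 ∧ Polynomial.eval₂ (D.iotaL y) x f = 0}

/-- **[J-2½] Lem. 5.1.3** (p.30 l.26–41; ground of Thm. 5.5.2 (1)–(2)): «every non-constant polynomial `f(T) ∈ L[T] ⊂ R[T]`
has a root in `R`. Thus `R` contains `L̄` as an embedded subring» — typed as the root statement. [claim: Joshi2023ATS2half,
status: disputed] -/
@[claim "Joshi2023ATS2half" "disputed"]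
def Lem513 : Prop :=
  ∀ (y : D.Arith) (f : Polynomial L), 0 < f.natDegree → ∃ x : D.arithRing y, Polynomial.eval₂ (D.iotaL y) x f = 0

/-- The elements of `K_{y_v}` algebraic over `L_v` — Thm. 5.5.2 (3)–(4)'s «preferred algebraic closure `L̄_v ⊂ K_v` of
`L_v`» (proof p.34 l.32–35). [claim: Joshi2023ATS2half, status: disputed] -/
def algClosureIn (y : D.Arith) (v : V) : Set (K v (y v)) :=
  {x | ∃ f : Polynomial (Lv v), f ≠ 0 ∧ Polynomial.eval₂ (D.emb v (y v)) x f = 0}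

/-- **[J-2½] Def. 5.2.1** (p.31 l.44–45): «two arithmeticoids `arith(L)_{y₁}`, `arith(L)_{y₂}` are TOPOLOGICALLY EQUIVALENT
if and only if their arithmetic rings are topologically isomorphic» (as topological rings). [claim: Joshi2023ATS2half,
status: disputed] -/
def TopEquivalent (y₁ y₂ : D.Arith) : Prop :=
  ∃ e : D.arithRing y₁ ≃+* D.arithRing y₂, Continuous e ∧ Continuous e.symm

/-- Topological equivalence is reflexive. [folklore] -/
theorem TopEquivalent.refl (y : D.Arith) : D.TopEquivalent y y :=
  ⟨RingEquiv.refl _, continuous_id, continuous_id⟩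

/-! ## §5.5 Basic properties (Thm. 5.5.2), §5.7 the three actions on arithmeticoids (Cor. 5.7.1) -/

/-- **[J-2½] Thm. 5.5.2 (3)–(4)** (p.34 l.22–25; proof l.32–35): «each arithmeticoid provides, for each `v ∈ V_L`, a Galois
category `F̂et(L_v)_{y_v}` of finite extensions of `L_v` contained in `K_v` and hence a preferred isomorph
`G_{L_v;y_v} = G_{L_v;K_v}` of the absolute Galois group» — typed as its ground: `L̄_v := algClosureIn y v` is an algebraic
closure of `L_v` (every non-constant polynomial over `L_v` has a root in it). (1)–(2) (the global Galois category
`F̂et(L)_y` in `R_y` and the isomorph `G_{L;y}`) rest on `Lem513` the same way; (5) «a preferred isomorph of the product group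
`𝔾_{L;y}`» is (4) over all `v`. The category-level packaging is prose here. [claim: Joshi2023ATS2half, status: disputed] -/
@[claim "Joshi2023ATS2half" "disputed"]
def Thm552_34 : Prop :=
  ∀ (y : D.Arith) (v : V) (f : Polynomial (Lv v)), 0 < f.natDegree →
    ∃ x ∈ D.algClosureIn y v, Polynomial.eval₂ (D.emb v (y v)) x f = 0

/-- **[J-2½] Thm. 5.5.2 (6)** (p.34 l.27) DERIVED: «the class of arithmeticoids of `L` is non-empty» — by the point
`y⁰ = (y⁰_v)_v` of the proof (p.35 l.1–18: the untilts `(L_v ↪ L̂̄_v, L̂̄^♭_v = L̂̄^♭_v)`). [claim: Joshi2023ATS2half, status: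
disputed] -/
theorem arith_nonempty : Nonempty D.Arith := ⟨fun v => D.pt0 v⟩

/-- The printed GROUND of Thm. 5.5.2 (7) (p.35 l.21–33): «by [Kedlaya and Temkin, 2018], there exists, for any `v ∈ V^non_L`,
a pair of closed classical points `y_{1,v}, y_{2,v}` such that the residue fields `K_{1,v}` and `K_{2,v}` are not
topologically isomorphic». [claim: Joshi2023ATS2half, status: disputed] -/
@[claim "Joshi2023ATS2half" "disputed"]
def LocalTopInequivalent : Prop :=
  ∀ v, v ∉ D.Varc → ∃ y₁ y₂ : Y v, ¬ ∃ e : K v y₁ ≃+* K v y₂, Continuous e ∧ Continuous e.symm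

/-- **[J-2½] Thm. 5.5.2 (7)** (p.34 l.28; proof p.35 l.21–33): «topologically inequivalent arithmeticoids of `L` also exist»
(cited by [J-III] Thm. 2.3.1 (b), seat T-05). Print's step from `LocalTopInequivalent` («choose `y₁, y₂ ∈ 𝒴_L` with these
`v`-components; then [they] are not topologically equivalent by construction») is not derived here. [claim:
Joshi2023ATS2half, status: disputed] -/
@[claim "Joshi2023ATS2half" "disputed"]
def Thm552_7 : Prop := ∃ y₁ y₂ : D.Arith, ¬ D.TopEquivalent y₁ y₂

/-- **[J-2½] Cor. 5.7.1** (p.36 l.1–9): «there is a natural action of each of the groups `L*`, `G_L` and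
`∏_{v ∈ V^non_L} Aut(𝒢(𝒪_{F_v}))` on the collection of arithmeticoids `{arith(L)_y : y ∈ 𝒴_L}` given by the action of these
groups on `𝒴_L` given by Theorem 4.2.3» — the three actions, on `Arith = 𝒴_L`. [claim: Joshi2023ATS2half, status: disputed] -/
def threeActions :
    (Lˣ →* (D.Arith ≃ₜ D.Arith)) × (D.GalProd →* (D.Arith ≃ₜ D.Arith)) × (((v : V) → A v) →* (D.Arith ≃ₜ D.Arith)) :=
  (D.unitAction, D.galAction, D.ltAction)

end DeformationDatum

end Summit.ABC.IUTFork.Joshi.ATS2h
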